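import Literature.Geometry.Riemannian.MetricFlowFDistance
import Mathlib.Topology.MetricSpace.Gluing
import HarnessLib

/-!
# Gluing two correspondences along the common metric flow (Bamler 2023, §5.2, Lemma 5.15)

R. Bamler, *Compactness theory of the space of super Ricci flows*, Invent. Math. 233 (2023), §5.2,
Lemma (arXiv v1 Lemma 114, combining correspondences): given correspondences `ℭ¹²` between
`𝒳¹, 𝒳²` and `ℭ²³` between `𝒳², 𝒳³` over the same `I''`, there is a correspondence `ℭ¹²³` between
`𝒳¹, 𝒳², 𝒳³` over `I''` whose restrictions to `{1, 2}` and `{2, 3}` are (isometric to) `ℭ¹²`, `ℭ²³`: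
*"for `t ∈ I''^{12,2} ∩ I''^{23,2}` let `Z_t` be the metric gluing of `Z¹²_t` and `Z²³_t` along the
isometric copies `φ^{12,2}_t(𝒳²_t)`, `φ^{23,2}_t(𝒳²_t)` (Lemma (combining isometric embeddings),
§2.4); for the remaining `t` take the disjoint union."* The `𝔽`-triangle inequality (Thm. 5.13)
only uses the resulting correspondence between `𝒳¹` and `𝒳³` together with the common isometric
copy of `𝒳²_t` in `Z_t`.

This file DEFINES that glued correspondence for the tree's two-flow correspondences
(`MetricFlow.Correspondence₂`, `MetricFlowFDistance.lean`):

* `Correspondence₂.GluedSpace ℭ₁₂ ℭ₂₃ t` / `Correspondence₂.gluedSpace` — for `t ∈ I''`, a metric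
  space `Z_t` with isometric embeddings `inl : Z¹²_t → Z_t`, `inr : Z²³_t → Z_t` which agree on
  `𝒳²_t` (`inl ∘ φ^{12,2}_t = inr ∘ φ^{23,1}_t`) whenever both middle embeddings are defined: Mathlib's
  metric gluing `Metric.GlueSpace` of `Z¹²_t`, `Z²³_t` along `𝒳²_t` when `𝒳²_t` is nonempty and both
  middle embeddings exist, and the disjoint union `Z¹²_t ⊕ Z²³_t` (`Metric.metricSpaceSum`)
  otherwise (the data are bundled in a structure so that no case distinction appears in types);
* `Correspondence₂.glue ℭ₁₂ ℭ₂₃ : Correspondence₂ 𝒳₁ 𝒳₃ I''` — **Lemma 5.15 for the pair `(1, 3)`**: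
  comparison spaces `Z_t` (with their Borel σ-algebras), domains `I''^{,1} := I''^{12,1}`,
  `I''^{,3} := I''^{23,3}`, embeddings `inl ∘ φ^{12,1}_t` and `inr ∘ φ^{23,3}_t`;
* `Correspondence₂.glueMid` — the common isometric copy of `𝒳²_t` in `Z_t`, and the pointwise
  estimate `edist_glue_le`:
  `d_{Z_t}(φ¹³₁ a, φ¹³₃ c) ≤ d_{Z¹²_t}(φ¹²₁ a, φ¹²₂ b) + d_{Z²³_t}(φ²³₁ b, φ²³₃ c)`, which is what the
  proof of Thm. 5.13 integrates.

What is NOT here: the correspondence between all THREE flows as one object (the tree has no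
`ℐ`-indexed correspondences yet), the gluing of countably many correspondences (second half of
the Lemma), and the identification of the restrictions with `ℭ¹²`, `ℭ²³` beyond the isometries
`inl`, `inr`.

## References

* R. H. Bamler, *Compactness theory of the space of super Ricci flows*, Invent. Math. 233 (2023),
  1121–1277 (arXiv:2008.09298), §2.4, Lemma (combining isometric embeddings); §5.2, Lemma 5.15
  (arXiv v1 Lemma 114) and the proof of Theorem 5.13. [Bamler2023]
-/

noncomputable section

open Set Function
open scoped Topology ENNReal NNReal

namespace Literature.Geometry.Riemannian

universe u

namespace MetricFlow

namespace Correspondence₂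

variable {I₁ I₂ I₃ : Set ℝ} {𝒳₁ : MetricFlow.{u} I₁} {𝒳₂ : MetricFlow.{u} I₂} {𝒳₃ : MetricFlow.{u} I₃}
  {I'' : Set ℝ}

/-- **The glued comparison space at time `t`, bundled** (Bamler 2023, §5.2, proof of Lemma 5.15):
a metric space `Z_t` with isometric embeddings of `Z¹²_t` and `Z²³_t` which agree on the two
isometric copies of `𝒳²_t` whenever both are defined.
[cite: Bamler2023, §5.2, Lemma 5.15 (arXiv v1 Lemma 114)] -/
structure GluedSpace (ℭ₁₂ : Correspondence₂ 𝒳₁ 𝒳₂ I'') (ℭ₂₃ : Correspondence₂ 𝒳₂ 𝒳₃ I'')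
    (t : I'') : Type (u + 1) where
  /-- The glued comparison space `Z_t`. -/
  carrier : Type u
  /-- Its metric. -/
  [metric : MetricSpace carrier]
  /-- The isometric embedding of `Z¹²_t`. -/
  inl : ℭ₁₂.Z t → carrier
  /-- The isometric embedding of `Z²³_t`. -/
  inr : ℭ₂₃.Z t → carrier
  /-- `inl` is an isometric embedding. -/
  isometry_inl : Isometry inl
  /-- `inr` is an isometric embedding. -/
  isometry_inr : Isometry inr
  /-- The two copies of `𝒳²_t` are identified. -/
  comm : ∀ (h₂ : (t : ℝ) ∈ ℭ₁₂.dom₂) (h₁ : (t : ℝ) ∈ ℭ₂₃.dom₁)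
    (x : 𝒳₂.Slice ⟨t, (ℭ₁₂.dom₂_subset h₂).1⟩), inl (ℭ₁₂.φ₂ t h₂ x) = inr (ℭ₂₃.φ₁ t h₁ x)

attribute [instance] GluedSpace.metric

/-- The disjoint union `Z¹²_t ⊕ Z²³_t` with Mathlib's sum metric, used when the two copies of
`𝒳²_t` need not be identified (no common middle embedding, or `𝒳²_t = ∅`).
[cite: Bamler2023, §5.2, Lemma 5.15 (arXiv v1 Lemma 114)] -/
def GluedSpace.sum (ℭ₁₂ : Correspondence₂ 𝒳₁ 𝒳₂ I'') (ℭ₂₃ : Correspondence₂ 𝒳₂ 𝒳₃ I'') (t : I'')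
    (hvac : ∀ (h₂ : (t : ℝ) ∈ ℭ₁₂.dom₂) (_ : (t : ℝ) ∈ ℭ₂₃.dom₁),
      IsEmpty (𝒳₂.Slice ⟨t, (ℭ₁₂.dom₂_subset h₂).1⟩)) :
    GluedSpace ℭ₁₂ ℭ₂₃ t where
  carrier := ℭ₁₂.Z t ⊕ ℭ₂₃.Z t
  metric := Metric.metricSpaceSum
  inl := Sum.inl
  inr := Sum.inr
  isometry_inl := Metric.isometry_inl
  isometry_inr := Metric.isometry_inr
  comm h₂ h₁ x := ((hvac h₂ h₁).false x).elim

/-- **The glued comparison space at time `t`** (Bamler 2023, §5.2, proof of Lemma 5.15; §2.4,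
Lemma (combining isometric embeddings)): the metric gluing (`Metric.GlueSpace`) of `Z¹²_t` and
`Z²³_t` along the isometric embeddings `φ^{12,2}_t`, `φ^{23,1}_t` of `𝒳²_t` when
`t ∈ I''^{12,2} ∩ I''^{23,1}` and `𝒳²_t ≠ ∅`, and the disjoint union otherwise.
[cite: Bamler2023, §5.2, Lemma 5.15 (arXiv v1 Lemma 114)] -/
def gluedSpace (ℭ₁₂ : Correspondence₂ 𝒳₁ 𝒳₂ I'') (ℭ₂₃ : Correspondence₂ 𝒳₂ 𝒳₃ I'') (t : I'') :
    GluedSpace ℭ₁₂ ℭ₂₃ t := by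
  classical
  exact if h : (t : ℝ) ∈ ℭ₁₂.dom₂ ∧ (t : ℝ) ∈ ℭ₂₃.dom₁ then
    if hne : Nonempty (𝒳₂.Slice ⟨t, (ℭ₁₂.dom₂_subset h.1).1⟩) then
      { carrier := Metric.GlueSpace (ℭ₁₂.isometry₂ t h.1) (ℭ₂₃.isometry₁ t h.2)
        metric := inferInstance
        inl := Metric.toGlueL (ℭ₁₂.isometry₂ t h.1) (ℭ₂₃.isometry₁ t h.2)
        inr := Metric.toGlueR (ℭ₁₂.isometry₂ t h.1) (ℭ₂₃.isometry₁ t h.2)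
        isometry_inl := Metric.toGlueL_isometry _ _
        isometry_inr := Metric.toGlueR_isometry _ _
        comm := fun _ _ x ↦ congrFun (Metric.toGlue_commute (ℭ₁₂.isometry₂ t h.1)
          (ℭ₂₃.isometry₁ t h.2)) x }
    else GluedSpace.sum ℭ₁₂ ℭ₂₃ t fun _ _ ↦ ⟨fun x ↦ hne ⟨x⟩⟩
  else GluedSpace.sum ℭ₁₂ ℭ₂₃ t fun h₂ h₁ ↦ (h ⟨h₂, h₁⟩).elim

/-- **Lemma 5.15 (arXiv v1 Lemma 114), for the outer pair: the glued correspondence between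
`𝒳¹` and `𝒳³` over `I''`** obtained from correspondences `ℭ¹²` (between `𝒳¹, 𝒳²`) and `ℭ²³`
(between `𝒳², 𝒳³`) over `I''`: comparison spaces the glued spaces `Z_t` (with their Borel
σ-algebras), domains `I''^{,1} := I''^{12,1}`, `I''^{,3} := I''^{23,3}`, embeddings
`φ¹_t := inl ∘ φ^{12,1}_t`, `φ³_t := inr ∘ φ^{23,3}_t`.
[cite: Bamler2023, §5.2, Lemma 5.15 (arXiv v1 Lemma 114)] -/
def glue (ℭ₁₂ : Correspondence₂ 𝒳₁ 𝒳₂ I'') (ℭ₂₃ : Correspondence₂ 𝒳₂ 𝒳₃ I'') :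
    Correspondence₂ 𝒳₁ 𝒳₃ I'' where
  Z t := (gluedSpace ℭ₁₂ ℭ₂₃ t).carrier
  instMetricSpace t := (gluedSpace ℭ₁₂ ℭ₂₃ t).metric
  instMeasurableSpace t := borel (gluedSpace ℭ₁₂ ℭ₂₃ t).carrier
  instBorelSpace t := @BorelSpace.mk _ _ (borel (gluedSpace ℭ₁₂ ℭ₂₃ t).carrier) rfl
  dom₁ := ℭ₁₂.dom₁
  dom₂ := ℭ₂₃.dom₂
  dom₁_subset := ℭ₁₂.dom₁_subset
  dom₂_subset := ℭ₂₃.dom₂_subset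
  φ₁ t ht := (gluedSpace ℭ₁₂ ℭ₂₃ ⟨t, (ℭ₁₂.dom₁_subset ht).2⟩).inl ∘ ℭ₁₂.φ₁ t ht
  φ₂ t ht := (gluedSpace ℭ₁₂ ℭ₂₃ ⟨t, (ℭ₂₃.dom₂_subset ht).2⟩).inr ∘ ℭ₂₃.φ₂ t ht
  isometry₁ t ht := (gluedSpace ℭ₁₂ ℭ₂₃ _).isometry_inl.comp (ℭ₁₂.isometry₁ t ht)
  isometry₂ t ht := (gluedSpace ℭ₁₂ ℭ₂₃ _).isometry_inr.comp (ℭ₂₃.isometry₂ t ht)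

variable (ℭ₁₂ : Correspondence₂ 𝒳₁ 𝒳₂ I'') (ℭ₂₃ : Correspondence₂ 𝒳₂ 𝒳₃ I'')

/-- The domains of the glued correspondence are `I''^{12,1}` and `I''^{23,3}`.
[cite: Bamler2023, §5.2, Lemma 5.15 (arXiv v1 Lemma 114)] -/
@[simp] theorem glue_dom₁ : (ℭ₁₂.glue ℭ₂₃).dom₁ = ℭ₁₂.dom₁ := rfl

/-- The domains of the glued correspondence are `I''^{12,1}` and `I''^{23,3}`.
[cite: Bamler2023, §5.2, Lemma 5.15 (arXiv v1 Lemma 114)] -/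
@[simp] theorem glue_dom₂ : (ℭ₁₂.glue ℭ₂₃).dom₂ = ℭ₂₃.dom₂ := rfl

/-- The glued correspondence is fully defined over `J` as soon as `ℭ¹²`'s first and `ℭ²³`'s second
family of embeddings are. [cite: Bamler2023, §5.2, Lemma 5.15 (arXiv v1 Lemma 114)] -/
theorem FullyDefinedOver.glue {J : Set ℝ} (h₁₂ : ℭ₁₂.FullyDefinedOver J)
    (h₂₃ : ℭ₂₃.FullyDefinedOver J) : (ℭ₁₂.glue ℭ₂₃).FullyDefinedOver J :=
  ⟨h₁₂.1, h₂₃.2⟩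

/-- The first embedding of the glued correspondence is `inl ∘ φ^{12,1}_t`.
[cite: Bamler2023, §5.2, Lemma 5.15 (arXiv v1 Lemma 114)] -/
theorem glue_φ₁ (t : ℝ) (ht : t ∈ ℭ₁₂.dom₁) :
    (ℭ₁₂.glue ℭ₂₃).φ₁ t ht =
      (gluedSpace ℭ₁₂ ℭ₂₃ ⟨t, (ℭ₁₂.dom₁_subset ht).2⟩).inl ∘ ℭ₁₂.φ₁ t ht := rfl

/-- The second embedding of the glued correspondence is `inr ∘ φ^{23,3}_t`.
[cite: Bamler2023, §5.2, Lemma 5.15 (arXiv v1 Lemma 114)] -/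
theorem glue_φ₂ (t : ℝ) (ht : t ∈ ℭ₂₃.dom₂) :
    (ℭ₁₂.glue ℭ₂₃).φ₂ t ht =
      (gluedSpace ℭ₁₂ ℭ₂₃ ⟨t, (ℭ₂₃.dom₂_subset ht).2⟩).inr ∘ ℭ₂₃.φ₂ t ht := rfl

/-- **The common isometric copy of `𝒳²_t` in the glued space** `Z_t` (`t ∈ I''^{12,2}`):
`ψ_t := inl ∘ φ^{12,2}_t`. [cite: Bamler2023, §5.2, Lemma 5.15 (arXiv v1 Lemma 114)] -/
def glueMid (t : ℝ) (h₂ : t ∈ ℭ₁₂.dom₂) :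
    𝒳₂.Slice ⟨t, (ℭ₁₂.dom₂_subset h₂).1⟩ → (ℭ₁₂.glue ℭ₂₃).Z ⟨t, (ℭ₁₂.dom₂_subset h₂).2⟩ :=
  (gluedSpace ℭ₁₂ ℭ₂₃ ⟨t, (ℭ₁₂.dom₂_subset h₂).2⟩).inl ∘ ℭ₁₂.φ₂ t h₂

/-- `ψ_t` is an isometric embedding. [cite: Bamler2023, §5.2, Lemma 5.15 (arXiv v1 Lemma 114)] -/
theorem isometry_glueMid (t : ℝ) (h₂ : t ∈ ℭ₁₂.dom₂) : Isometry (ℭ₁₂.glueMid ℭ₂₃ t h₂) :=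
  (gluedSpace ℭ₁₂ ℭ₂₃ _).isometry_inl.comp (ℭ₁₂.isometry₂ t h₂)

/-- On `𝒳²_t` the two embeddings into the glued space agree: `ψ_t = inr ∘ φ^{23,1}_t` for
`t ∈ I''^{12,2} ∩ I''^{23,1}`. [cite: Bamler2023, §5.2, Lemma 5.15 (arXiv v1 Lemma 114)] -/
theorem glueMid_eq (t : ℝ) (h₂ : t ∈ ℭ₁₂.dom₂) (h₁ : t ∈ ℭ₂₃.dom₁)
    (x : 𝒳₂.Slice ⟨t, (ℭ₁₂.dom₂_subset h₂).1⟩) :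
    ℭ₁₂.glueMid ℭ₂₃ t h₂ x =
      (gluedSpace ℭ₁₂ ℭ₂₃ ⟨t, (ℭ₁₂.dom₂_subset h₂).2⟩).inr (ℭ₂₃.φ₁ t h₁ x) :=
  (gluedSpace ℭ₁₂ ℭ₂₃ ⟨t, (ℭ₁₂.dom₂_subset h₂).2⟩).comm h₂ h₁ x

/-- **Distances from `𝒳¹_t` to `𝒳²_t` are computed in `Z¹²_t`**: `d_{Z_t}(φ¹_t a, ψ_t b) =
d_{Z¹²_t}(φ^{12,1}_t a, φ^{12,2}_t b)` (`inl` is an isometric embedding).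
[cite: Bamler2023, §5.2, Lemma 5.15 (arXiv v1 Lemma 114)] -/
theorem edist_glue_φ₁_glueMid (t : ℝ) (ht : t ∈ ℭ₁₂.dom₁) (h₂ : t ∈ ℭ₁₂.dom₂)
    (a : 𝒳₁.Slice ⟨t, (ℭ₁₂.dom₁_subset ht).1⟩) (b : 𝒳₂.Slice ⟨t, (ℭ₁₂.dom₂_subset h₂).1⟩) :
    edist ((ℭ₁₂.glue ℭ₂₃).φ₁ t ht a) (ℭ₁₂.glueMid ℭ₂₃ t h₂ b) =
      edist (ℭ₁₂.φ₁ t ht a) (ℭ₁₂.φ₂ t h₂ b) :=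
  (gluedSpace ℭ₁₂ ℭ₂₃ _).isometry_inl.edist_eq _ _

/-- **Distances from `𝒳²_t` to `𝒳³_t` are computed in `Z²³_t`**: `d_{Z_t}(ψ_t b, φ³_t c) =
d_{Z²³_t}(φ^{23,1}_t b, φ^{23,3}_t c)` (`ψ_t = inr ∘ φ^{23,1}_t`, `inr` isometric).
[cite: Bamler2023, §5.2, Lemma 5.15 (arXiv v1 Lemma 114)] -/
theorem edist_glueMid_glue_φ₂ (t : ℝ) (h₂ : t ∈ ℭ₁₂.dom₂) (h₁ : t ∈ ℭ₂₃.dom₁) (ht : t ∈ ℭ₂₃.dom₂)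
    (b : 𝒳₂.Slice ⟨t, (ℭ₁₂.dom₂_subset h₂).1⟩) (c : 𝒳₃.Slice ⟨t, (ℭ₂₃.dom₂_subset ht).1⟩) :
    edist (ℭ₁₂.glueMid ℭ₂₃ t h₂ b) ((ℭ₁₂.glue ℭ₂₃).φ₂ t ht c) =
      edist (ℭ₂₃.φ₁ t h₁ b) (ℭ₂₃.φ₂ t ht c) := by
  rw [glueMid_eq ℭ₁₂ ℭ₂₃ t h₂ h₁ b]
  exact (gluedSpace ℭ₁₂ ℭ₂₃ _).isometry_inr.edist_eq _ _

end Correspondence₂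

end MetricFlow

/-- **The pointwise triangle inequality through the common copy of `𝒳²_t`** (the estimate
integrated in the proof of Bamler 2023, Thm. 5.13): for `t ∈ I''^{12,1} ∩ I''^{12,2} ∩ I''^{23,1} ∩
I''^{23,3}`, `a ∈ 𝒳¹_t`, `b ∈ 𝒳²_t`, `c ∈ 𝒳³_t`,
`d_{Z_t}(φ¹_t a, φ³_t c) ≤ d_{Z¹²_t}(φ^{12,1}_t a, φ^{12,2}_t b) + d_{Z²³_t}(φ^{23,1}_t b, φ^{23,3}_t c)`
in the glued correspondence `ℭ₁₂.glue ℭ₂₃`.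
[cite: Bamler2023, §5.2, proof of Thm. 5.13 via Prop. 5.14 and Lemma 5.15] -/
theorem edist_glue_le {I₁ I₂ I₃ : Set ℝ} {𝒳₁ : MetricFlow.{u} I₁} {𝒳₂ : MetricFlow.{u} I₂}
    {𝒳₃ : MetricFlow.{u} I₃} {I'' : Set ℝ} (ℭ₁₂ : MetricFlow.Correspondence₂ 𝒳₁ 𝒳₂ I'')
    (ℭ₂₃ : MetricFlow.Correspondence₂ 𝒳₂ 𝒳₃ I'') (t : ℝ) (ht₁ : t ∈ ℭ₁₂.dom₁) (h₂ : t ∈ ℭ₁₂.dom₂)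
    (h₁ : t ∈ ℭ₂₃.dom₁) (ht₃ : t ∈ ℭ₂₃.dom₂) (a : 𝒳₁.Slice ⟨t, (ℭ₁₂.dom₁_subset ht₁).1⟩)
    (b : 𝒳₂.Slice ⟨t, (ℭ₁₂.dom₂_subset h₂).1⟩) (c : 𝒳₃.Slice ⟨t, (ℭ₂₃.dom₂_subset ht₃).1⟩) :
    edist ((ℭ₁₂.glue ℭ₂₃).φ₁ t ht₁ a) ((ℭ₁₂.glue ℭ₂₃).φ₂ t ht₃ c) ≤
      edist (ℭ₁₂.φ₁ t ht₁ a) (ℭ₁₂.φ₂ t h₂ b) + edist (ℭ₂₃.φ₁ t h₁ b) (ℭ₂₃.φ₂ t ht₃ c) := by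
  rw [← ℭ₁₂.edist_glue_φ₁_glueMid ℭ₂₃ t ht₁ h₂ a b, ← ℭ₁₂.edist_glueMid_glue_φ₂ ℭ₂₃ t h₂ h₁ ht₃ b c]
  exact edist_triangle _ _ _

end Literature.Geometry.Riemannian

end
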